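import Mathlib
import HarnessLib
import Summits.ResolutionOfSingularities.ResolutionOfSingularities.Theorems.WildQuotientsWildQuotientResolutionS1aCoarseChart
import Summits.ResolutionOfSingularities.ResolutionOfSingularities.Theorems.WildQuotientsWildQuotientResolutionS1aProducerStep

/-!
# S1a — A5b-(G1c): the σ-NORM COVER of the blow-up chart union — `CoverClause` from the elementary symmetric functions of
# the σ-orbits of the centre

(crux stmt-ResolutionOfSingularities-15640 `WildQuotients.WildQuotientResolution`, line `Sketch`; S1 =
stmt-ResolutionOfSingularities-17941 `CyclicQuotientFourfolds`, stub `stub_localGame` (producer); S1a H3-scheme —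
H3 v3 `…S1aProducerStep` (`CoverClause`, p572348), idea-2 H4c v2 `h123/S1aMoveStep.lean` 297974ed0abe676b
(`BlowupNodeAtlas p`, cover conjunct (G1c)); res-L1-w45c-plan-1 RE-ASSIGN 2026-08-27T21:37:59Z («033: A5b-(G1c) = the
σ-NORM COVER clause … (X̄ᵢ^p ∈ (e₁,…,e_p))»), SIG 21:52:40Z. [OURS · L1 W4.5c] — NOT a statement of any manuscript;
standard algebra (Vieta); AI-produced, weaker than expert review. Def-free. Prover res-D-pv-033.)

**`coverClause_of_sigma_norms`** — for a graded ring automorphism `σ` with `σ^[p] = id` (the last two clauses of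
`IsTameNode p B 𝒜 σ`), a homogeneous centre `f` with positive weights `w` and a `σ`-adapted weighted filtration
(`σ(𝒥ₙ) ⊆ 𝒥ₙ`): `CoverClause B 𝒜 σ f w` holds, with the `c·p` witnesses
`b_{i,k} = e_{k+1}(−f_i, −σ f_i, …, −σ^{p−1} f_i)` of `T`-degree `(k+1)·w_i`:
they are `σ`-INVARIANT (`σ` rotates the orbit — `sigma_esymmOrbit`), HOMOGENEOUS of degree `(k+1)•δ_i`
(`esymmOrbit_mem_graded`), lie in `𝒥_{(k+1) w_i}` (`esymmOrbit_mem_weightedFiltration`), and VIETA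
`∏ⱼ (f_i − σʲ f_i) = 0 = f_i^p + Σ_k b_{i,k} f_i^{p−1−k}` gives `(f_i T^{w_i})^p ∈ (b_{i,k} T^{(k+1) w_i})_k` in `R^w`
(`u'_pow_mem_span_esymmOrbit`).
-/

-- single-problem summit: the doubled namespace component `ResolutionOfSingularities` is forced
set_option linter.dupNamespace false

noncomputable section

open Polynomial Literature.AlgebraicGeometry.Resolution
open scoped LaurentPolynomial

namespace Summit.ResolutionOfSingularities.ResolutionOfSingularities.Theorems.WildQuotientResolution.S1.CoarseChart

universe u v

variable {ι : Type v} [AddCommGroup ι] [DecidableEq ι] {B : Type u} [CommRing B]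
  (𝒜 : ι → AddSubgroup B) [GradedRing 𝒜] (σ : B ≃+* B) (p : ℕ)

/-! ## The orbit and its elementary symmetric functions -/

/-- The `k`-th elementary symmetric function of the negated `σ`-orbit `(−x, −σ x, …, −σ^{p−1} x)`:
`Σ_{|t| = k} ∏_{j ∈ t} (−σʲ x)`. -/
theorem esymmOrbit_def (x : B) (k : ℕ) :
    ((Finset.univ : Finset (Fin p)).val.map fun j : Fin p => -((⇑σ)^[j] x)).esymm k =
      ∑ t ∈ (Finset.univ : Finset (Fin p)).powersetCard k, ∏ j ∈ t, -((⇑σ)^[j] x) :=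
  Finset.esymm_map_val _ _ k

/-- **`σ` rotates the orbit**, hence fixes its elementary symmetric functions (`σ^[p] = id`). [folklore] -/
theorem sigma_esymmOrbit (hp : 0 < p) (hσp : ∀ b : B, (⇑σ)^[p] b = b) (x : B) (k : ℕ) :
    σ (((Finset.univ : Finset (Fin p)).val.map fun j : Fin p => -((⇑σ)^[j] x)).esymm k) =
      ((Finset.univ : Finset (Fin p)).val.map fun j : Fin p => -((⇑σ)^[j] x)).esymm k := by
  obtain ⟨p', rfl⟩ : ∃ p', p = p' + 1 := ⟨p - 1, by omega⟩
  rw [esymmOrbit_def, map_sum]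
  -- `σ (∏_{j ∈ t} −σʲ x) = ∏_{j ∈ t} −σ^{j+1} x = ∏_{j ∈ rot t} −σʲ x`
  have hrot : ∀ j : Fin (p' + 1), σ (-((⇑σ)^[j] x)) = -((⇑σ)^[(finRotate (p' + 1) j : ℕ)] x) := by
    intro j
    rw [map_neg]
    congr 1
    by_cases hj : j = Fin.last p'
    · subst hj
      rw [finRotate_last, Fin.val_zero, Function.iterate_zero, id, Fin.val_last,
        ← Function.iterate_succ_apply' (⇑σ) p' x]
      exact hσp x
    · rw [coe_finRotate_of_ne_last hj, Function.iterate_succ_apply']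
  have hterm : ∀ t : Finset (Fin (p' + 1)), σ (∏ j ∈ t, -((⇑σ)^[j] x)) =
      ∏ j ∈ (finRotate (p' + 1)).finsetCongr t, -((⇑σ)^[j] x) := by
    intro t
    rw [map_prod, Equiv.finsetCongr_apply, Finset.prod_map]
    exact Finset.prod_congr rfl fun j _ => hrot j
  simp_rw [hterm]
  exact Finset.sum_equiv (finRotate (p' + 1)).finsetCongr (fun t => by
    simp [Finset.mem_powersetCard, Equiv.finsetCongr_apply, Finset.card_map]) (fun t _ => rfl)

/-- Products over a finset of elements of `𝒜 d` lie in `𝒜 (|t| • d)`. [folklore] -/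
theorem finset_prod_mem_graded_const {κ : Type*} (t : Finset κ) (g : κ → B) (d : ι) (hg : ∀ j ∈ t, g j ∈ 𝒜 d) :
    (∏ j ∈ t, g j) ∈ 𝒜 (t.card • d) := by
  have h := SetLike.prod_mem_graded 𝒜 (fun _ => d) g hg
  rwa [Finset.sum_const] at h

/-- The elementary symmetric functions of the orbit of a homogeneous element are homogeneous (σ graded).
[folklore] -/
theorem esymmOrbit_mem_graded (hσA : ∀ d : ι, ∀ b ∈ 𝒜 d, σ b ∈ 𝒜 d) {x : B} {d : ι} (hx : x ∈ 𝒜 d)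
    (k : ℕ) :
    ((Finset.univ : Finset (Fin p)).val.map fun j : Fin p => -((⇑σ)^[j] x)).esymm k ∈ 𝒜 (k • d) := by
  have hit : ∀ n : ℕ, (⇑σ)^[n] x ∈ 𝒜 d := by
    intro n
    induction n with
    | zero => exact hx
    | succ n ih => rw [Function.iterate_succ_apply']; exact hσA d _ ih
  rw [esymmOrbit_def]
  refine AddSubgroup.sum_mem _ fun t ht => ?_
  have hcard : t.card = k := (Finset.mem_powersetCard.mp ht).2
  rw [← hcard]
  exact finset_prod_mem_graded_const 𝒜 t _ d fun j _ => neg_mem (hit j)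

/-- Products over a finset of elements of `𝒥_a` lie in `𝒥_{|t| a}` (multiplicativity of an ideal filtration).
[folklore] -/
theorem finset_prod_mem_filtration {A : Type*} [CommRing A] (J : IdealFiltration A) {κ : Type*} (t : Finset κ)
    (g : κ → A) (a : ℕ) (hg : ∀ j ∈ t, g j ∈ J.ideal a) : (∏ j ∈ t, g j) ∈ J.ideal (t.card * a) := by
  classical
  induction t using Finset.induction_on with
  | empty => simp [J.ideal_zero]
  | insert j t hj ih =>
    rw [Finset.prod_insert hj, Finset.card_insert_of_notMem hj, Nat.succ_mul, add_comm]
    exact J.mul_le _ _ (Ideal.mul_mem_mul (hg j (Finset.mem_insert_self j t))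
      (ih fun j' hj' => hg j' (Finset.mem_insert_of_mem hj')))

/-- The elementary symmetric functions of the orbit of `f_i` lie in the weighted filtration (σ-adapted 𝒥).
[folklore] -/
theorem esymmOrbit_mem_weightedFiltration {c : ℕ} (f : Fin c → B) (w : Fin c → ℕ)
    (hσJ : ∀ n, ((weightedFiltration f w).ideal n).map (σ : B →+* B) ≤ (weightedFiltration f w).ideal n)
    (i : Fin c) (k : ℕ) :
    ((Finset.univ : Finset (Fin p)).val.map fun j : Fin p => -((⇑σ)^[j] (f i))).esymm k ∈
      (weightedFiltration f w).ideal (k * w i) := by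
  have hit : ∀ n : ℕ, (⇑σ)^[n] (f i) ∈ (weightedFiltration f w).ideal (w i) := by
    intro n
    induction n with
    | zero => exact mem_weightedFiltration_ideal f w i
    | succ n ih =>
      rw [Function.iterate_succ_apply']
      exact hσJ _ (Ideal.mem_map_of_mem (σ : B →+* B) ih)
  rw [esymmOrbit_def]
  refine Ideal.sum_mem _ fun t ht => ?_
  have hcard : t.card = k := (Finset.mem_powersetCard.mp ht).2
  rw [← hcard]
  exact finset_prod_mem_filtration (weightedFiltration f w) t _ (w i) fun j _ => Submodule.neg_mem _ (hit j)

/-! ## Vieta: `f^p ∈ (e₁, …, e_p)` -/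

/-- **Vieta for the orbit**: `f^p = − Σ_{k<p} e_{k+1}(−orbit) · f^{p−1−k}` (the factor `f − σ⁰ f = 0` kills the
product `∏ⱼ (f − σʲ f)`). [folklore] -/
theorem pow_eq_neg_sum_esymmOrbit (hp : 0 < p) (x : B) :
    x ^ p = -∑ k ∈ Finset.range p,
      ((Finset.univ : Finset (Fin p)).val.map fun j : Fin p => -((⇑σ)^[j] x)).esymm (k + 1) * x ^ (p - 1 - k) := by
  set s : Multiset B := (Finset.univ : Finset (Fin p)).val.map fun j : Fin p => -((⇑σ)^[j] x) with hs
  have hcard : Multiset.card s = p := by simp [hs]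
  have hV := Multiset.prod_X_add_C_eq_sum_esymm s
  -- evaluate at `x`: the left side vanishes
  have h0 : ((s.map fun r => X + C r).prod).eval x = 0 := by
    rw [Polynomial.eval_multiset_prod, Multiset.map_map, hs, Multiset.map_map, ← Finset.prod_eq_multiset_prod]
    exact Finset.prod_eq_zero (Finset.mem_univ ⟨0, hp⟩) (by simp)
  rw [hV, Polynomial.eval_finsetSum, hcard, Finset.sum_range_succ'] at h0
  simp only [Polynomial.eval_mul, Polynomial.eval_C, Polynomial.eval_pow, Polynomial.eval_X] at h0
  have he0 : s.esymm 0 = 1 := by simp [Multiset.esymm, Multiset.powersetCard_zero_left]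
  rw [he0, one_mul, Nat.sub_zero] at h0
  have hidx : ∀ k ∈ Finset.range p, s.esymm (k + 1) * x ^ (p - (k + 1)) = s.esymm (k + 1) * x ^ (p - 1 - k) :=
    fun k _ => by rw [show p - (k + 1) = p - 1 - k by omega]
  rw [Finset.sum_congr rfl hidx] at h0
  linear_combination h0

set_option maxHeartbeats 1600000 in
/-- **Nilpotency in `R^w`**: `(f_i T^{w_i})^p` lies in the ideal of `R^w` generated by the
`e_{k+1}(−orbit_i) · T^{(k+1) w_i}`, `k < p`. [folklore] -/
theorem u'_pow_mem_span_esymmOrbit (hp : 0 < p) {c : ℕ} (f : Fin c → B) (w : Fin c → ℕ)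
    (hσJ : ∀ n, ((weightedFiltration f w).ideal n).map (σ : B →+* B) ≤ (weightedFiltration f w).ideal n)
    (i : Fin c) :
    cobordantAlgebra.u' f w i ^ p ∈ Ideal.span (Set.range fun k : Fin p =>
      (⟨LaurentPolynomial.C (((Finset.univ : Finset (Fin p)).val.map fun j : Fin p => -((⇑σ)^[j] (f i))).esymm
          (k + 1)) * LaurentPolynomial.T (((k + 1) * w i : ℕ) : ℤ),
        C_mul_T_mem_cobordantAlgebra f w (esymmOrbit_mem_weightedFiltration σ p f w hσJ i (k + 1))⟩ :
        ↥(cobordantAlgebra f w))) := by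
  -- abbreviate the esymm's
  set e : Fin p → B := fun k =>
    ((Finset.univ : Finset (Fin p)).val.map fun j : Fin p => -((⇑σ)^[j] (f i))).esymm (k + 1) with he
  -- the identity `u'^p = Σ_k (-u'^{p-1-k}) · h_k` in `R^w`
  have key : cobordantAlgebra.u' f w i ^ p = ∑ k : Fin p, (-(cobordantAlgebra.u' f w i ^ (p - 1 - k))) *
      (⟨LaurentPolynomial.C (e k) * LaurentPolynomial.T (((k + 1) * w i : ℕ) : ℤ),
        C_mul_T_mem_cobordantAlgebra f w (esymmOrbit_mem_weightedFiltration σ p f w hσJ i (k + 1))⟩ :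
        ↥(cobordantAlgebra f w)) := by
    apply Subtype.ext
    simp only [SubmonoidClass.coe_pow, cobordantAlgebra.coe_u', AddSubmonoidClass.coe_finsetSum,
      MulMemClass.coe_mul, NegMemClass.coe_neg]
    -- each summand is `-(C(e_k f^{p-1-k}) · T^{p w_i})`
    have hT : ∀ k : Fin p, -((LaurentPolynomial.C (f i) * LaurentPolynomial.T (w i : ℤ) : B[T;T⁻¹]) ^ (p - 1 - k)) *
        (LaurentPolynomial.C (e k) * LaurentPolynomial.T (((k + 1) * w i : ℕ) : ℤ)) =
        -(LaurentPolynomial.C (e k * f i ^ (p - 1 - k)) * LaurentPolynomial.T ((p : ℤ) * (w i : ℤ))) := by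
      intro k
      have hk : (k : ℕ) < p := k.2
      have hexp : ((p - 1 - k : ℕ) : ℤ) * (w i : ℤ) + (((k + 1) * w i : ℕ) : ℤ) = (p : ℤ) * (w i : ℤ) := by
        have h1 : ((p - 1 - k : ℕ) : ℤ) = (p : ℤ) - 1 - k := by omega
        push_cast
        rw [h1]
        ring
      rw [mul_pow, ← map_pow, LaurentPolynomial.T_pow, neg_mul, map_mul]
      congr 1
      calc LaurentPolynomial.C (f i ^ (p - 1 - ↑k)) * LaurentPolynomial.T (↑(p - 1 - ↑k) * ↑(w i)) *
            (LaurentPolynomial.C (e k) * LaurentPolynomial.T ↑((↑k + 1) * w i))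
          = (LaurentPolynomial.C (e k) * LaurentPolynomial.C (f i ^ (p - 1 - ↑k))) *
              (LaurentPolynomial.T (↑(p - 1 - ↑k) * ↑(w i)) * LaurentPolynomial.T ↑((↑k + 1) * w i)) := by ring
        _ = _ := by rw [← LaurentPolynomial.T_add, hexp]
    rw [Finset.sum_congr rfl fun k _ => hT k, Finset.sum_neg_distrib, ← Finset.sum_mul, ← map_sum, mul_pow,
      ← map_pow, LaurentPolynomial.T_pow, pow_eq_neg_sum_esymmOrbit σ p hp (f i), map_neg, neg_mul,
      Finset.sum_range (fun k => ((Finset.univ : Finset (Fin p)).val.map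
        fun j : Fin p => -((⇑σ)^[j] (f i))).esymm (k + 1) * f i ^ (p - 1 - k))]
  rw [key]
  exact Ideal.sum_mem _ fun k _ => Ideal.mul_mem_left _ _ (Ideal.subset_span ⟨k, rfl⟩)

/-! ## (G1c) The σ-norm cover -/

/-- **(G1c) THE σ-NORM COVER.** For a graded ring automorphism `σ` with `σ^[p] = id` (the last two clauses of
`IsTameNode p B 𝒜 σ`), a homogeneous centre `f` (degrees `δ`) with positive weights `w` and a `σ`-adapted weighted
filtration, the COVER clause of the one-node producer step holds: the `c·p` elements
`b_{i,k} = e_{k+1}(−f_i, −σ f_i, …, −σ^{p−1} f_i)` (`T`-degree `(k+1) w_i`, `ι`-degree `(k+1)•δ_i`) are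
`σ`-invariant, homogeneous, `b_{i,k} T^{(k+1) w_i} ∈ R^w`, and `(f_i T^{w_i})^p ∈ (b_{i,k} T^{(k+1) w_i})` —
«X̄ᵢ^p ∈ (e₁, …, e_p)». [OURS · L1 W4.5c] -/
theorem coverClause_of_sigma_norms (hp : 0 < p) (hσA : ∀ d : ι, ∀ b ∈ 𝒜 d, σ b ∈ 𝒜 d)
    (hσp : ∀ b : B, (⇑σ)^[p] b = b) {c : ℕ} (f : Fin c → B) (δ : Fin c → ι) (w : Fin c → ℕ)
    (hf : ∀ i, f i ∈ 𝒜 (δ i)) (hw : ∀ i, 0 < w i)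
    (hσJ : ∀ n, ((weightedFiltration f w).ideal n).map (σ : B →+* B) ≤ (weightedFiltration f w).ideal n) :
    ProducerStep.CoverClause B 𝒜 σ f w := by
  refine ⟨c * p,
    fun j => ((((finProdFinEquiv.symm j).2 : ℕ) + 1) * w (finProdFinEquiv.symm j).1 : ℕ),
    fun j => (((finProdFinEquiv.symm j).2 : ℕ) + 1) • δ (finProdFinEquiv.symm j).1,
    fun j => ((Finset.univ : Finset (Fin p)).val.map
      fun j' : Fin p => -((⇑σ)^[j'] (f (finProdFinEquiv.symm j).1))).esymm (((finProdFinEquiv.symm j).2 : ℕ) + 1),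
    fun j => C_mul_T_mem_cobordantAlgebra f w
      (esymmOrbit_mem_weightedFiltration σ p f w hσJ (finProdFinEquiv.symm j).1 _),
    fun j => ⟨?_, ?_, ?_⟩, fun i => ⟨p, ?_⟩⟩
  · have := hw (finProdFinEquiv.symm j).1
    positivity
  · exact esymmOrbit_mem_graded 𝒜 σ p hσA (hf _) _
  · exact sigma_esymmOrbit σ p hp hσp _ _
  · refine Ideal.span_mono ?_ (u'_pow_mem_span_esymmOrbit σ p hp f w hσJ i)
    rintro _ ⟨k, rfl⟩
    refine ⟨finProdFinEquiv (i, k), ?_⟩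
    simp only [Equiv.symm_apply_apply]


end Summit.ResolutionOfSingularities.ResolutionOfSingularities.Theorems.WildQuotientResolution.S1.CoarseChart

end
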